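import Summits.Ventures.GridStability.Models.InverterVSM

/-!
# GridStability/Models/InverterMatchingDQ — matching-controlled converter in the converter dq-frame AS PRINTED (Arghir–Jouini–Dörfler 2018 (10a)–(10c)): storage (13), the passivity identity of Thm. 3, and GLOBAL exponential convergence under condition (11)/(17)

Cell `gridfusion` (LADDER-GRIDFUSION, rung G3; seat gridfusion-model-3 (g8); models/MODEL-3-NOTES.md §0 row «matching
control», §1 (P22)); lead g7 RULING 8g (3): #100-cand «G3.c-MATCHING-GFM-GLOBAL-THM». Fifth grid-forming control family
of the structural table (droop band ★ #79 / PLL divergence ★ #75 / dVOC ball ★ #84 / droop+QV box ★ #87) — the one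
whose print carries a GLOBAL theorem.

Source (read on the page; corpus key paper:arxiv-1706.09495) [cite: ArghirJouiniDorfler2018] C. Arghir, T. Jouini,
F. Dörfler, Automatica 95 (2018) 273–282 = arXiv:1706.09495: §2.2 averaged model (3a)–(3c) [p0003 L67–L80]; §3 matching
control (6a)–(6b) `m_αβ = μ(−sin θ, cos θ)`, `θ̇ = η v_dc` [p0004 L70–L88]; §3.1 dq-frame closed loop (10a)–(10c)
`C_dc v̇_dc = −G_dc v_dc + i_dc − (μ/2) e₂ᵀ i_dq`, `L i̇_dq = −R i_dq − v_dc ηL J i_dq + (μ/2) e₂ v_dc − v_dq`,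
`C v̇_dq = −G v_dq − v_dc ηC J v_dq − i_l,dq + i_dq` («independent of the angle state variable») [p0005 L1–L19];
Thm. 3 (strict passivity in dq-frame), condition (11) `C²‖v*_dq‖²/(4G) + L²‖i*_dq‖²/(4R) < G_dc/η²`, error system
(12), storage `V₁ = ½C_dc ṽ_dc² + ½L ĩᵀĩ + ½C ṽᵀṽ` (13), `V̇₁ = −x̃ᵀQx̃ − ṽ_dqᵀĩ_l,dq + ĩ_dc ṽ_dc`,
`Q = [[G_dc, ½(ηLJi*)ᵀ, ½(ηCJv*)ᵀ], [·, RI, 0], [·, 0, GI]]` (14) [p0005 L24–L119]; §3.2 P-control (15)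
`i_dc = i_dc,ref − K_p(v_dc − v_dc,ref)`, load (16) `i_l = (G_l I + B_l J)v + s_l` (constant `s_l` in the dq-frame),
Cor. 4: under (17) (= (11) with `G_dc + K_p`, `G + G_l`) «the steady state x* is unique and globally asymptotically
stable» [p0005 L124–L140, p0006 L1–L40]. `J = [[0, −1], [1, 0]]`, `e₂ = (0, 1)`.

WHAT IS TYPED / CERTIFIED (kernel; std axioms; 0 kit). §1 `MatchingDQ`: (10a)–(10c) with (15), (16) substituted — the
SAME equations with `G_dc ↦ G_dc + K_p`, `i_dc ↦ i_dc,ref + K_p v_dc,ref`, `G ↦ G + G_l`, an extra skew term `−B_l J v`,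
`i_l ↦ s_l`; the bare (10) is `B_l = 0`. State `(v_dc, i_d, i_q, v_d, v_q) : Fin 5 → ℝ`. §2 storage (13) about an
equilibrium `x*`; PASSIVITY IDENTITY of Thm. 3 with the incremental port inputs `(ĩ_dc, ĩ_l)`:
`d/dt V₁ = −x̃ᵀQx̃ + ĩ_dc ṽ_dc − ṽ_dqᵀĩ_l` along every solution (`hasDerivWithinAt_storage_port`); closed ports:
`d/dt V₁ = −x̃ᵀQx̃` (`hasDerivWithinAt_storage`) — algebra: the `(μ/2)` switching terms cancel, the `J`-terms are skew.
§3 `x̃ᵀQx̃ ≥ 2ρV₁ ⇒ V₁(t) ≤ V₁(0)e^{−2ρt}` (`storage_le_mul_exp`; for an instance the hypothesis is ONE 5×5 rational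
PSD certificate `Q − ρ diag(C_dc, L, L, C, C) ⪰ 0`). §4 the printed condition discharged symbolically:
`m := η²L²‖i*‖²/(4R) + η²C²‖v*‖²/(4G) < G_dc` (= (11)·η²) with `C_dc, L, C, R, G > 0` ⇒ explicit `ρ > 0`
(`exists_rate_of_cond`) ⇒ along EVERY solution on `[0, ∞)` `V₁(x(t) − x*) → 0` (`storage_tendsto_zero_of_cond`) and
the equilibrium is unique (`equilibrium_unique_of_cond`) = Cor. 4 for the MODEL, with a rate.

THREE COLUMNS. CERTIFIED: identities/inequalities above. MODELLED («M_match-dq»): averaged 2-level converter (no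
switching ripple), balanced, dq-frame attached to the converter's virtual angle, ONE unit, no network, static shunt
load + co-rotating source (16), no current/modulation limits (MV-INV-5; print: «the analysis does not pertain to a setup
containing multiple (grid-forming) inverters» [p0006 L44–L47]). «Global» = of the ERROR equilibrium of this closed-port
model under (11). NOT typed: the αβ↔dq change of frame to `InverterVSM.Matching` ([cite: JouiniSun2022] §2.1);
existence of `x*`. VALIDATED: nothing. No declaration says a converter is stable.
-/
noncomputable section

open Real Set Filter Finset Topology

namespace Summit.Ventures.GridStability.Models

/-- Parameters of the dq-frame matching-controlled converter (10a)–(10c) with the dc-side P-control (15) and the static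
load (16) substituted [cite: ArghirJouiniDorfler2018, (10), (15), (16)]: `Cdc`, total dc conductance `Gdc` (printed
`G_dc + K_p`), constant dc injection `idc` (printed `i_dc,ref + K_p v_dc,ref`), filter `L`, `R`, `C`, total shunt
conductance `G` (printed `G + G_l`), load susceptance `Bl`, gain `η`, modulation amplitude `μ`, constant load source
`s = (s₁, s₂)` (dq components of `s_l`). MODELLED: MV-INV-5. -/
structure MatchingDQ where
  /-- dc-link capacitance `C_dc` -/ Cdc : ℝ
  /-- total dc conductance `G_dc + K_p` -/ Gdc : ℝ
  /-- constant dc current injection `i_dc,ref + K_p v_dc,ref` -/ idc : ℝ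
  /-- filter inductance `L` -/ L : ℝ
  /-- filter resistance `R` -/ R : ℝ
  /-- filter capacitance `C` -/ C : ℝ
  /-- total shunt conductance `G + G_l` -/ G : ℝ
  /-- load shunt susceptance `B_l` -/ Bl : ℝ
  /-- matching gain `η = ω₀ / v_dc,ref` -/ η : ℝ
  /-- modulation amplitude `μ` -/ μ : ℝ
  /-- load current source, d component -/ s₁ : ℝ
  /-- load current source, q component -/ s₂ : ℝ

namespace MatchingDQ

variable (K : MatchingDQ)

/-- State `x = (v_dc, i_d, i_q, v_d, v_q)` indexed by `Fin 5`. -/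
abbrev State : Type := Fin 5 → ℝ

/-- Right-hand sides of (10a)–(10c) (with (15), (16)) BEFORE division by `C_dc, L, L, C, C`:
`C_dc v̇_dc = −G_dc v_dc + i_dc − (μ/2) i_q`; `L i̇_d = −R i_d + ηL v_dc i_q − v_d`;
`L i̇_q = −R i_q − ηL v_dc i_d + (μ/2) v_dc − v_q`; `C v̇_d = −G v_d + ηC v_dc v_q + B_l v_q + i_d − s₁`;
`C v̇_q = −G v_q − ηC v_dc v_d − B_l v_d + i_q − s₂` (`J i = (−i_q, i_d)`, `e₂ = (0, 1)`).
[cite: ArghirJouiniDorfler2018, (10a)–(10c), (15), (16)] -/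
def rhs (x : State) : State :=
  ![-(K.Gdc * x 0) + K.idc - K.μ / 2 * x 2,
    -(K.R * x 1) + K.η * K.L * x 0 * x 2 - x 3,
    -(K.R * x 2) - K.η * K.L * x 0 * x 1 + K.μ / 2 * x 0 - x 4,
    -(K.G * x 3) + K.η * K.C * x 0 * x 4 + K.Bl * x 4 + x 1 - K.s₁,
    -(K.G * x 4) - K.η * K.C * x 0 * x 3 - K.Bl * x 3 + x 2 - K.s₂]

/-- Storage coefficients `(C_dc, L, L, C, C)` of (13). -/
def coef : State := ![K.Cdc, K.L, K.L, K.C, K.C]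
/-- The vector field of (10a)–(10c): `ẋ_k = rhs_k(x) / coef_k`. -/
def field (x : State) : State := fun k => K.rhs x k / K.coef k

/-- A curve solves the dq-frame model (10a)–(10c) on the time set `s` (tree convention: `HasDerivWithinAt` within
`s`). [cite: ArghirJouiniDorfler2018, (10a)–(10c)] -/
def IsSolutionOn (γ : ℝ → State) (s : Set ℝ) : Prop :=
  ∀ t ∈ s, HasDerivWithinAt γ (K.field (γ t)) s t

/-- `x*` is an equilibrium (the steady state `x* = (v*_dc, i*_dq, v*_dq)` of Thm. 3 / Cor. 4): all right-hand sides
vanish. Existence is NOT claimed here. [cite: ArghirJouiniDorfler2018, Thm. 3] -/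
def IsEquilibrium (xs : State) : Prop := ∀ k, K.rhs xs k = 0

/-- The incremental storage function (13) about `x*`:
`V₁ = ½ C_dc ṽ_dc² + ½ L (ĩ_d² + ĩ_q²) + ½ C (ṽ_d² + ṽ_q²)`, `x̃ = x − x*`. [cite: ArghirJouiniDorfler2018, (13)] -/
def storage (xs x : State) : ℝ := (∑ k, K.coef k * (x k - xs k) ^ 2) / 2

/-- The dissipation quadratic form `x̃ᵀ Q x̃` of (14) (closed ports):
`G_dc ṽ_dc² + R‖ĩ‖² + G‖ṽ‖² + η ṽ_dc (L ĩᵀJ i* + C ṽᵀJ v*)`, `ĩᵀ J i* = ĩ_q i*_d − ĩ_d i*_q`.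
[cite: ArghirJouiniDorfler2018, (14)] -/
def dissipation (xs x : State) : ℝ :=
  K.Gdc * (x 0 - xs 0) ^ 2 + K.R * ((x 1 - xs 1) ^ 2 + (x 2 - xs 2) ^ 2)
    + K.G * ((x 3 - xs 3) ^ 2 + (x 4 - xs 4) ^ 2)
    + K.η * (x 0 - xs 0) * (K.L * ((x 2 - xs 2) * xs 1 - (x 1 - xs 1) * xs 2)
        + K.C * ((x 4 - xs 4) * xs 3 - (x 3 - xs 3) * xs 4))

/-! ## §2 The dissipation identity of Theorem 3 (closed ports) -/

/-- **Algebraic core of Thm. 3.** At an equilibrium `x*`: `Σ_k x̃_k · rhs_k(x) = −x̃ᵀQx̃` for every state `x`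
(the modulation terms cancel — lossless switching — and the `J`-terms are skew).
[cite: ArghirJouiniDorfler2018, proof of Thm. 3] -/
theorem sum_err_mul_rhs (xs x : State) (hxs : K.IsEquilibrium xs) :
    ∑ k, (x k - xs k) * K.rhs x k = -K.dissipation xs x := by
  have h0 := hxs 0; have h1 := hxs 1; have h2 := hxs 2; have h3 := hxs 3; have h4 := hxs 4
  simp only [rhs, Matrix.cons_val_zero, Matrix.cons_val_one, Matrix.cons_val] at h0 h1 h2 h3 h4
  simp only [Fin.sum_univ_five, rhs, dissipation, Matrix.cons_val_zero, Matrix.cons_val_one, Matrix.cons_val]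
  linear_combination (x 0 - xs 0) * h0 + (x 1 - xs 1) * h1 + (x 2 - xs 2) * h2 + (x 3 - xs 3) * h3
    + (x 4 - xs 4) * h4

/-- Right-hand sides with the incremental PORT inputs of Thm. 3 added: `u = (ĩ_dc, ĩ_l,d, ĩ_l,q)` enters as
`+ĩ_dc` in (10a) and `−ĩ_l,dq` in (10c) (input `u = (i_dc, −i_l,dq)`, output `y = (v_dc, v_dq)`).
[cite: ArghirJouiniDorfler2018, (10), (12)] -/
def rhsPort (u : ℝ × ℝ × ℝ) (x : State) : State :=
  ![K.rhs x 0 + u.1, K.rhs x 1, K.rhs x 2, K.rhs x 3 - u.2.1, K.rhs x 4 - u.2.2]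

/-- The vector field with port inputs: `ẋ_k = rhsPort_k(u, x) / coef_k`. -/
def fieldPort (u : ℝ × ℝ × ℝ) (x : State) : State := fun k => K.rhsPort u x k / K.coef k

/-- **Passivity identity of Thm. 3 (algebraic core, open ports).** At an equilibrium `x*` of the closed-port
system: `Σ_k x̃_k · rhsPort_k(u, x) = −x̃ᵀQx̃ + ĩ_dc ṽ_dc − ṽ_dqᵀ ĩ_l,dq` — the supply rate of the port pair
`(ĩ_dc, −ĩ_l,dq) / (ṽ_dc, ṽ_dq)`. [cite: ArghirJouiniDorfler2018, Thm. 3] -/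
theorem sum_err_mul_rhsPort (xs x : State) (hxs : K.IsEquilibrium xs) (u : ℝ × ℝ × ℝ) :
    ∑ k, (x k - xs k) * K.rhsPort u x k
      = -K.dissipation xs x + u.1 * (x 0 - xs 0) - ((x 3 - xs 3) * u.2.1 + (x 4 - xs 4) * u.2.2) := by
  have h := K.sum_err_mul_rhs xs x hxs
  simp only [Fin.sum_univ_five] at h
  simp only [Fin.sum_univ_five, rhsPort, Matrix.cons_val_zero, Matrix.cons_val_one, Matrix.cons_val]
  linear_combination h

variable {K}

/-- **Theorem 3 as printed (kernel, open ports).** Nonzero `C_dc, L, C`, equilibrium `x*` of the closed-port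
system, any port-input signal `u(t) = (ĩ_dc, ĩ_l,dq)(t)`: along every curve with
`ẋ(t) = fieldPort(u(t), x(t))` within the time set,
`d/dt V₁(x(t) − x*) = −x̃ᵀQx̃ + ĩ_dc ṽ_dc − ṽ_dqᵀĩ_l,dq`. [cite: ArghirJouiniDorfler2018, Thm. 3, (12)–(14)] -/
theorem hasDerivWithinAt_storage_port (hC : K.Cdc ≠ 0) (hL : K.L ≠ 0) (hC' : K.C ≠ 0) {xs : State}
    (hxs : K.IsEquilibrium xs) {u : ℝ → ℝ × ℝ × ℝ} {γ : ℝ → State} {s : Set ℝ}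
    (h : ∀ t ∈ s, HasDerivWithinAt γ (K.fieldPort (u t) (γ t)) s t) {t : ℝ} (ht : t ∈ s) :
    HasDerivWithinAt (fun r => K.storage xs (γ r))
      (-K.dissipation xs (γ t) + (u t).1 * (γ t 0 - xs 0)
        - ((γ t 3 - xs 3) * (u t).2.1 + (γ t 4 - xs 4) * (u t).2.2)) s t := by
  have hcoef : ∀ k, K.coef k ≠ 0 := by
    intro k
    fin_cases k <;> simp [coef, hC, hL, hC']
  have hk : ∀ k ∈ (Finset.univ : Finset (Fin 5)), HasDerivWithinAt (fun r => K.coef k * (γ r k - xs k) ^ 2)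
      (K.coef k * (((2 : ℕ) : ℝ) * (γ t k - xs k) ^ (2 - 1) * K.fieldPort (u t) (γ t) k)) s t :=
    fun k _ => ((((hasDerivWithinAt_pi.1 (h t ht)) k).sub_const (xs k)).pow 2).const_mul (K.coef k)
  have hS := (HasDerivWithinAt.fun_sum hk).div_const (2 : ℝ)
  refine hS.congr_deriv ?_
  rw [← K.sum_err_mul_rhsPort xs (γ t) hxs (u t), Finset.sum_div]
  refine Finset.sum_congr rfl fun k _ => ?_
  simp only [fieldPort, Nat.cast_ofNat, pow_one, Nat.add_one_sub_one]
  field_simp [hcoef k]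

/-- **Theorem 3, closed ports (kernel).** Nonzero `C_dc, L, C`, equilibrium `x*`: along every solution,
`d/dt V₁(x(t) − x*) = −x̃ᵀQx̃` within the time set. [cite: ArghirJouiniDorfler2018, Thm. 3, (12)–(14)] -/
theorem hasDerivWithinAt_storage (hC : K.Cdc ≠ 0) (hL : K.L ≠ 0) (hC' : K.C ≠ 0) {xs : State}
    (hxs : K.IsEquilibrium xs) {γ : ℝ → State} {s : Set ℝ} (h : K.IsSolutionOn γ s) {t : ℝ} (ht : t ∈ s) :
    HasDerivWithinAt (fun r => K.storage xs (γ r)) (-K.dissipation xs (γ t)) s t := by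
  have hcoef : ∀ k, K.coef k ≠ 0 := by
    intro k
    fin_cases k <;> simp [coef, hC, hL, hC']
  have hk : ∀ k ∈ (Finset.univ : Finset (Fin 5)), HasDerivWithinAt (fun r => K.coef k * (γ r k - xs k) ^ 2)
      (K.coef k * (((2 : ℕ) : ℝ) * (γ t k - xs k) ^ (2 - 1) * K.field (γ t) k)) s t :=
    fun k _ => ((((hasDerivWithinAt_pi.1 (h t ht)) k).sub_const (xs k)).pow 2).const_mul (K.coef k)
  have hS := (HasDerivWithinAt.fun_sum hk).div_const (2 : ℝ)
  refine hS.congr_deriv ?_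
  rw [← K.sum_err_mul_rhs xs (γ t) hxs, Finset.sum_div]
  refine Finset.sum_congr rfl fun k _ => ?_
  simp only [field, Nat.cast_ofNat, pow_one, Nat.add_one_sub_one]
  field_simp [hcoef k]

/-! ## §3 Exponential decay of the storage under a dissipation rate -/

/-- Scalar comparison (local copy of `AggregateFrequency.sub_le_mul_exp` with `K = 0`): `φ' ≤ −c φ` within
`[0, T]` ⇒ `φ(t) ≤ φ(0) e^{−ct}`. -/
theorem le_mul_exp_of_deriv_le {φ φ' : ℝ → ℝ} {T c : ℝ}
    (hφ : ∀ t ∈ Icc 0 T, HasDerivWithinAt φ (φ' t) (Icc 0 T) t)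
    (hle : ∀ t ∈ Icc 0 T, φ' t ≤ -(c * φ t)) {t : ℝ} (ht : t ∈ Icc 0 T) :
    φ t ≤ φ 0 * exp (-(c * t)) := by
  set g : ℝ → ℝ := fun s => φ s * exp (c * s) with hg
  have hexpd : ∀ s, HasDerivWithinAt (fun r => exp (c * r)) (exp (c * s) * (c * 1)) (Icc 0 T) s :=
    fun s => ((hasDerivWithinAt_id s _).const_mul c).exp
  have hder : ∀ s ∈ Icc 0 T, HasDerivWithinAt g ((φ' s + c * φ s) * exp (c * s)) (Icc 0 T) s := by
    intro s hs
    refine ((hφ s hs).mul (hexpd s)).congr_deriv ?_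
    ring
  have hanti : AntitoneOn g (Icc 0 T) := by
    refine antitoneOn_of_hasDerivWithinAt_nonpos (convex_Icc 0 T)
      (f' := fun s => (φ' s + c * φ s) * exp (c * s))
      (fun s hs => (hder s hs).continuousWithinAt) (fun s hs => ?_) (fun s hs => ?_)
    · exact (hder s (interior_subset hs)).mono interior_subset
    · have hs' : s ∈ Icc 0 T := interior_subset hs
      exact mul_nonpos_of_nonpos_of_nonneg (by linarith [hle s hs']) (exp_pos _).le
  have hg0 := hanti ⟨le_rfl, ht.1.trans ht.2⟩ ht ht.1
  simp only [hg, mul_zero, exp_zero, mul_one] at hg0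
  have hmul := mul_le_mul_of_nonneg_right hg0 (exp_pos (-(c * t))).le
  have he : exp (c * t) * exp (-(c * t)) = 1 := by rw [← exp_add]; simp
  calc φ t = φ t * (exp (c * t) * exp (-(c * t))) := by rw [he, mul_one]
    _ = φ t * exp (c * t) * exp (-(c * t)) := by ring
    _ ≤ φ 0 * exp (-(c * t)) := hmul

/-- **Decay.** If `x̃ᵀQx̃ ≥ 2ρ V₁(x̃)` at every state (for an instance: one 5×5 PSD certificate
`Q − ρ diag(C_dc, L, L, C, C) ⪰ 0`), then along every solution on `[0, T]`:
`V₁(x(t) − x*) ≤ V₁(x(0) − x*) e^{−2ρt}`. -/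
theorem storage_le_mul_exp (hC : K.Cdc ≠ 0) (hL : K.L ≠ 0) (hC' : K.C ≠ 0) {xs : State}
    (hxs : K.IsEquilibrium xs) {ρ : ℝ} (hρ : ∀ x, 2 * ρ * K.storage xs x ≤ K.dissipation xs x)
    {T : ℝ} {γ : ℝ → State} (h : K.IsSolutionOn γ (Icc 0 T)) {t : ℝ} (ht : t ∈ Icc 0 T) :
    K.storage xs (γ t) ≤ K.storage xs (γ 0) * exp (-(2 * ρ * t)) := by
  exact le_mul_exp_of_deriv_le (φ := fun r => K.storage xs (γ r)) (φ' := fun r => -K.dissipation xs (γ r))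
    (c := 2 * ρ) (T := T) (fun r hr => hasDerivWithinAt_storage hC hL hC' hxs h hr)
    (fun r hr => by linarith [hρ (γ r)]) ht

/-- Restriction of a solution on `[0, ∞)` to `[0, T]`. -/
theorem isSolutionOn_Icc_of_Ici {γ : ℝ → State} (h : K.IsSolutionOn γ (Ici 0)) (T : ℝ) :
    K.IsSolutionOn γ (Icc 0 T) :=
  fun t ht => (h t (mem_Ici.2 ht.1)).mono Icc_subset_Ici_self

/-- **Convergence of the storage to zero** for a positive rate `ρ`, along every solution on `[0, ∞)`. -/
theorem storage_tendsto_zero (hC : 0 < K.Cdc) (hL : 0 < K.L) (hC' : 0 < K.C) {xs : State}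
    (hxs : K.IsEquilibrium xs) {ρ : ℝ} (hρpos : 0 < ρ) (hρ : ∀ x, 2 * ρ * K.storage xs x ≤ K.dissipation xs x)
    {γ : ℝ → State} (h : K.IsSolutionOn γ (Ici 0)) :
    Tendsto (fun t => K.storage xs (γ t)) atTop (𝓝 0) := by
  have hnn : ∀ x, 0 ≤ K.storage xs x := fun x =>
    div_nonneg (Finset.sum_nonneg fun k _ => mul_nonneg
      (by fin_cases k <;> simp [coef, hC.le, hL.le, hC'.le]) (sq_nonneg _)) zero_le_two
  have h1 : Tendsto (fun t : ℝ => exp (-(2 * ρ * t))) atTop (𝓝 0) :=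
    tendsto_exp_neg_atTop_nhds_zero.comp (tendsto_id.const_mul_atTop (by positivity))
  refine tendsto_of_tendsto_of_tendsto_of_le_of_le' tendsto_const_nhds
    (by simpa using h1.const_mul (K.storage xs (γ 0))) (Eventually.of_forall fun t => hnn (γ t)) ?_
  filter_upwards [eventually_ge_atTop 0] with t ht
  exact storage_le_mul_exp hC.ne' hL.ne' hC'.ne' hxs hρ (isSolutionOn_Icc_of_Ici h t) ⟨ht, le_rfl⟩

/-! ## §4 The printed condition (11)/(17) gives an explicit rate -/

variable (K)

/-- The printed margin quantity `m = η²L²‖i*_dq‖²/(4R) + η²C²‖v*_dq‖²/(4G)` (left side of (11)/(17) times `η²`).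
[cite: ArghirJouiniDorfler2018, (11), (17)] -/
def margin (xs : State) : ℝ :=
  K.η ^ 2 * K.L ^ 2 * (xs 1 ^ 2 + xs 2 ^ 2) / (4 * K.R) + K.η ^ 2 * K.C ^ 2 * (xs 3 ^ 2 + xs 4 ^ 2) / (4 * K.G)

/-- AM–GM with a determinant bound: if `X² ≤ 4 a b` with `a ≥ 0`, `b ≥ 0` (read `b` as `R‖ĩ‖²`-type), then
`u X ≥ −((a/t) u² + t b)` for every `t > 0`. -/
theorem cross_ge {X a b u t : ℝ} (ha : 0 ≤ a) (hb : 0 ≤ b) (ht : 0 < t) (hX : X ^ 2 ≤ 4 * a * b) :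
    -(a / t * u ^ 2 + t * b) ≤ u * X := by
  rcases ha.eq_or_lt with ha0 | ha0
  · have hX0 : X = 0 := by
      have : X ^ 2 ≤ 0 := by simpa [← ha0] using hX
      exact pow_eq_zero_iff (n := 2) (by norm_num) |>.1 (le_antisymm this (sq_nonneg X))
    subst hX0
    have hnn : 0 ≤ a / t * u ^ 2 + t * b := by positivity
    rw [mul_zero]
    linarith
  · have key : 4 * a * t * (a / t * u ^ 2 + t * b + u * X)
        = (2 * a * u + t * X) ^ 2 + t ^ 2 * (4 * a * b - X ^ 2) := by
      field_simp
      ring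
    have hpos : 0 < 4 * a * t := by positivity
    have hnn : 0 ≤ 4 * a * t * (a / t * u ^ 2 + t * b + u * X) := by
      rw [key]; nlinarith [sq_nonneg (2 * a * u + t * X), sq_nonneg t]
    have := (mul_nonneg_iff_of_pos_left hpos).1 hnn
    linarith

/-- Cauchy–Schwarz in `ℝ²` in the shape used below (`r > 0`):
`(a b (p c − q d))² ≤ 4 · (a²b²(c² + d²)/(4r)) · (r (q² + p²))`. -/
theorem sq_cross_le (a b p q c d : ℝ) {r : ℝ} (hr : 0 < r) :
    (a * b * (p * c - q * d)) ^ 2 ≤ 4 * (a ^ 2 * b ^ 2 * (c ^ 2 + d ^ 2) / (4 * r)) * (r * (q ^ 2 + p ^ 2)) := by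
  have h1 : (p * c - q * d) ^ 2 ≤ (p ^ 2 + q ^ 2) * (c ^ 2 + d ^ 2) := by nlinarith [sq_nonneg (p * d + q * c)]
  have e : 4 * (a ^ 2 * b ^ 2 * (c ^ 2 + d ^ 2) / (4 * r)) * (r * (q ^ 2 + p ^ 2))
      = (a * b) ^ 2 * ((p ^ 2 + q ^ 2) * (c ^ 2 + d ^ 2)) := by
    field_simp
    ring
  rw [e, mul_pow]
  exact mul_le_mul_of_nonneg_left h1 (sq_nonneg _)

/-- **Lower bound on the dissipation form** for every `t ∈ ]0, 1]`-type parameter `t > 0` (`R, G > 0`):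
`x̃ᵀQx̃ ≥ (G_dc − m/t) ṽ_dc² + (1 − t)(R‖ĩ‖² + G‖ṽ‖²)`. -/
theorem dissipation_ge (hR : 0 < K.R) (hG : 0 < K.G) (xs x : State) {t : ℝ} (ht : 0 < t) :
    (K.Gdc - K.margin xs / t) * (x 0 - xs 0) ^ 2
        + (1 - t) * (K.R * ((x 1 - xs 1) ^ 2 + (x 2 - xs 2) ^ 2) + K.G * ((x 3 - xs 3) ^ 2 + (x 4 - xs 4) ^ 2))
      ≤ K.dissipation xs x := by
  set u := x 0 - xs 0
  set e1 := x 1 - xs 1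
  set e2 := x 2 - xs 2
  set e3 := x 3 - xs 3
  set e4 := x 4 - xs 4
  have hXL := sq_cross_le K.η K.L e2 e1 (xs 1) (xs 2) hR
  have hXC := sq_cross_le K.η K.C e4 e3 (xs 3) (xs 4) hG
  have hL' := cross_ge (u := u) (by positivity) (by positivity) ht hXL
  have hC' := cross_ge (u := u) (by positivity) (by positivity) ht hXC
  have hdis : K.dissipation xs x = K.Gdc * u ^ 2 + K.R * (e1 ^ 2 + e2 ^ 2) + K.G * (e3 ^ 2 + e4 ^ 2)
      + u * (K.η * K.L * (e2 * xs 1 - e1 * xs 2)) + u * (K.η * K.C * (e4 * xs 3 - e3 * xs 4)) := by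
    simp only [dissipation, u, e1, e2, e3, e4]; ring
  have hm : K.margin xs / t = K.η ^ 2 * K.L ^ 2 * (xs 1 ^ 2 + xs 2 ^ 2) / (4 * K.R) / t
      + K.η ^ 2 * K.C ^ 2 * (xs 3 ^ 2 + xs 4 ^ 2) / (4 * K.G) / t := by
    unfold margin; rw [add_div]
  rw [hdis, hm]
  nlinarith [hL', hC']

/-- **The printed condition yields a rate.** `C_dc, L, C, R, G > 0` and `m < G_dc` (condition (11)/(17) in the
substituted constants) ⇒ there is `ρ > 0` with `x̃ᵀQx̃ ≥ 2ρ V₁(x̃)` at every state (explicitly: with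
`t = (m + G_dc)/(2 G_dc)`, `ρ = min((G_dc − m/t)/C_dc, (1 − t)R/L, (1 − t)G/C)`).
[cite: ArghirJouiniDorfler2018, Thm. 3 / Cor. 4 (positive definiteness of Q under (11)/(17))] -/
theorem exists_rate_of_cond (hC : 0 < K.Cdc) (hL : 0 < K.L) (hC' : 0 < K.C) (hR : 0 < K.R) (hG : 0 < K.G)
    {xs : State} (hcond : K.margin xs < K.Gdc) :
    ∃ ρ : ℝ, 0 < ρ ∧ ∀ x, 2 * ρ * K.storage xs x ≤ K.dissipation xs x := by
  have hm0 : 0 ≤ K.margin xs := by unfold margin; positivity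
  have hg : 0 < K.Gdc := hm0.trans_lt hcond
  set t := (K.margin xs + K.Gdc) / (2 * K.Gdc) with ht_def
  have ht : 0 < t := by positivity
  have ht1 : t < 1 := by rw [ht_def, div_lt_one (by positivity)]; linarith
  have ha : 0 < K.Gdc - K.margin xs / t := by
    have : K.margin xs / t < K.Gdc := by
      rw [div_lt_iff₀ ht, ht_def]
      field_simp
      nlinarith
    linarith
  set a := K.Gdc - K.margin xs / t
  set ρ := min (a / K.Cdc) (min ((1 - t) * K.R / K.L) ((1 - t) * K.G / K.C)) with hρ_def
  have hρa : ρ ≤ a / K.Cdc := min_le_left _ _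
  have hρb : ρ ≤ (1 - t) * K.R / K.L := (min_le_right _ _).trans (min_le_left _ _)
  have hρc : ρ ≤ (1 - t) * K.G / K.C := (min_le_right _ _).trans (min_le_right _ _)
  refine ⟨ρ, ?_, fun x => ?_⟩
  · have h1 : 0 < a / K.Cdc := div_pos ha hC
    have h2 : 0 < (1 - t) * K.R / K.L := by have := sub_pos.2 ht1; positivity
    have h3 : 0 < (1 - t) * K.G / K.C := by have := sub_pos.2 ht1; positivity
    exact lt_min h1 (lt_min h2 h3)
  · have hlow := K.dissipation_ge hR hG xs x ht
    have hst : 2 * ρ * K.storage xs x = ρ * K.Cdc * (x 0 - xs 0) ^ 2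
        + ρ * K.L * ((x 1 - xs 1) ^ 2 + (x 2 - xs 2) ^ 2) + ρ * K.C * ((x 3 - xs 3) ^ 2 + (x 4 - xs 4) ^ 2) := by
      simp only [storage, Fin.sum_univ_five, coef, Matrix.cons_val_zero, Matrix.cons_val_one, Matrix.cons_val]
      ring
    have e1 : ρ * K.Cdc ≤ a := by rwa [le_div_iff₀ hC] at hρa
    have e2 : ρ * K.L ≤ (1 - t) * K.R := by rwa [le_div_iff₀ hL] at hρb
    have e3 : ρ * K.C ≤ (1 - t) * K.G := by rwa [le_div_iff₀ hC'] at hρc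
    rw [hst]
    nlinarith [sq_nonneg (x 0 - xs 0), sq_nonneg (x 1 - xs 1), sq_nonneg (x 2 - xs 2), sq_nonneg (x 3 - xs 3),
      sq_nonneg (x 4 - xs 4), hR, hG]

variable {K}

/-- **Corollary 4 for the MODEL (kernel): GLOBAL convergence with a rate.** `C_dc, L, C, R, G > 0`, equilibrium
`x*` with `m(x*) < G_dc`: along EVERY solution on `[0, ∞)`, `V₁(x(t) − x*) → 0` (hence `x(t) → x*` componentwise,
`V₁` being a positive-definite diagonal quadratic form). [cite: ArghirJouiniDorfler2018, Cor. 4] -/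
theorem storage_tendsto_zero_of_cond (hC : 0 < K.Cdc) (hL : 0 < K.L) (hC' : 0 < K.C) (hR : 0 < K.R)
    (hG : 0 < K.G) {xs : State} (hxs : K.IsEquilibrium xs) (hcond : K.margin xs < K.Gdc)
    {γ : ℝ → State} (h : K.IsSolutionOn γ (Ici 0)) :
    Tendsto (fun t => K.storage xs (γ t)) atTop (𝓝 0) := by
  obtain ⟨ρ, hρ, hρ'⟩ := K.exists_rate_of_cond hC hL hC' hR hG hcond
  exact storage_tendsto_zero hC hL hC' hxs hρ hρ' h

/-- **Uniqueness of the steady state (Cor. 4).** Under the same hypotheses any equilibrium `x*'` equals `x*`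
(the constant curve at `x*'` is a solution whose storage must tend to `0`). [cite: ArghirJouiniDorfler2018, Cor. 4] -/
theorem equilibrium_unique_of_cond (hC : 0 < K.Cdc) (hL : 0 < K.L) (hC' : 0 < K.C) (hR : 0 < K.R)
    (hG : 0 < K.G) {xs : State} (hxs : K.IsEquilibrium xs) (hcond : K.margin xs < K.Gdc)
    {xs' : State} (hxs' : K.IsEquilibrium xs') : xs' = xs := by
  have hsol : K.IsSolutionOn (fun _ => xs') (Ici 0) := by
    intro t _
    have h0 : K.field xs' = 0 := by
      funext k; simp [field, hxs' k]
    rw [h0]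
    exact hasDerivWithinAt_const _ _ _
  have hlim := storage_tendsto_zero_of_cond hC hL hC' hR hG hxs hcond hsol
  have hconst : K.storage xs xs' = 0 := tendsto_nhds_unique tendsto_const_nhds hlim
  have hcoef : ∀ k, 0 < K.coef k := by intro k; fin_cases k <;> simp [coef, hC, hL, hC']
  have hterm : ∀ k, K.coef k * (xs' k - xs k) ^ 2 = 0 := by
    have hsum : ∑ k, K.coef k * (xs' k - xs k) ^ 2 = 0 := by
      unfold storage at hconst; linarith
    intro k
    exact (Finset.sum_eq_zero_iff_of_nonneg fun j _ => mul_nonneg (hcoef j).le (sq_nonneg _)).1 hsum k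
      (mem_univ k)
  funext k
  have := hterm k
  rcases mul_eq_zero.1 this with h0 | h0
  · exact absurd h0 (hcoef k).ne'
  · exact sub_eq_zero.1 (pow_eq_zero_iff (n := 2) (by norm_num) |>.1 h0)

end MatchingDQ

end Summit.Ventures.GridStability.Models

end
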